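import Literature.NumberTheory.Rogawski1990.ArchStableSideChartRead               -- ★ p849891 R4 (LH2-p04): `stableOrbitalIntegralRel_endoTorus_mul_eq_stableSum∕_stOrbFamH`, `flipSet_mem_regG`; brings R1, (EXH-H), T-MEAS, B1
import Literature.NumberTheory.Automorphic.ArchEndoscopicStableClassExhaustion    -- ★ p849970 (UNIQ-H) `setOf_isArchStablyConjH_out_eq_image_flipSet`; ★ p849928 flips (`isArchStablyConjH_endoTorus_flipSet`, …)
import Literature.NumberTheory.Rogawski1990.ArchChartBoxCoherence                 -- ★ p849921 R3 (LH1-p02): the `endoGL` Cayley-frame kit, `GLnMixedPiEquiv` gluing pattern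
import Literature.NumberTheory.Automorphic.ArchEndoscopicChartOrbFree             -- ★ B2 (LH2-p04): `measure_chartBoxImg_pos`
import Literature.MeasureTheory.Group.QuotientOrbitalNormalizerInvariance         -- ★ (β) p849797 (LH2-p04): `map_eq_self_of_involutive`
import HarnessLib

/-!
# Box coherence ACROSS THE FLIPS: the frame's torus mass of the chart box is the same at every flip point (the `hbox` of R4 (READ-H)), and READ-H discharged
# (Rogawski 1990 §1.7, §4.1, §4.3 (4.3.1), §8.2; Shelstad 1979 §4; Langlands–Shelstad 1987 §1.3–1.4)

Topic `NumberTheory/Rogawski1990`; namespaces `Literature.NumberTheory.Automorphic.UnitaryGroup` (§1) and `Literature.NumberTheory.Rogawski1990` (§2–§4).  THEOREMS ONLY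
(no `def`, no instance, no notation, no axiom, no named fact, no `sorry`).  Cell `pub/hodgecm-mathlib`, crux H413 (`stmt-HodgeConjecture-24833`), F0∕P3c line LH3 (closer
stub `stub_N9`, DIRECT ROAD, organ `stub_N9read`); the LAST flagged hypothesis `hbox` of R4 ED. 1 (★ p849891, LH2-p04 (g3); LH3-plan (g2) deal 2026-09-02T06:30:06Z),
after `hinj` (★ p849928) and `hidx` (★ p849970).

THE MATHEMATICS.  Fix a chart `S`, `c ∈ RegG S`, and a flip `T ⊆ univ ∖ S`; `γ = endoTorus S c` and `γ_T = endoTorus S (flipSet T c)` are `G`-regular, stably conjugate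
(★ p849928), NOT conjugate in `H_∞`, and have the same centraliser `T_S` (★ R1 `chartTorusH_eq_centralizer_of_mem_regS`).
* §1 ONE element `y ∈ GL₃(L ⊗ ℝ)` conjugates `ι_∞(endoTorus S c₀)` to `ι_∞(endoTorus S (flipSet T c₀))` for EVERY `c₀` (place-wise `ι(P J P⁻¹, 1)` at `w ∈ T`, `1`
  elsewhere; glued through ★ `GLnMixedPiEquiv` — the mirror of ★ R3 `exists_forall_conj_endoEmbArch_endoTorus_eq_gprimeTorus`).
* §2 Hence the stable centraliser transport `e : Z_{G_∞}(ι γ) ≃ₜ* Z_{G_∞}(ι γ_T)` composed with `ι_∞|_{Z(γ)}` is «flip the coordinates»: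
  `e (ι z) = ι (endoTorus S (flipSet T c₀))` for `↑z = endoTorus S c₀` (★ `coe_archStableCentralizerEquiv_eq_of_conj_eq`).
* §3 In a frame in print's measure convention ((W_H)+(C_H)+(C)): (C_H) at `γ` and `γ_T` and (C) between `ι γ ↔ ι γ_T` give `t_H(γ_T) = Ψ_* t_H(γ)` on `T_S`, where `Ψ`
  is the flip automorphism of `T_S` — a continuous INVOLUTION; `t_H(γ)` is a Haar measure on `Z(γ) = T_S` (frame, ★ `atPoint_eq_quotientMeasure_tH_of_isArchGRegular`),
  and an involutive automorphism preserves Haar measure (★ (β) `map_eq_self_of_involutive`): **`map_subgroupCongr_symm_tH_endoTorus_flipSet_eq`** — the two torus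
  measures, read on `T_S`, COINCIDE; in particular the box masses agree (`toReal_map_tH_endoTorus_flipSet_chartBoxImg_eq`) and are positive.
* §4 **READ-H DISCHARGED**: `stableOrbitalIntegralRel_endoTorus_mul_boxMass_eq_stableSum` ∕ `…_eq_stOrbFamH` — ★ R4 with `hidx` ≔ ★ p849970, `hinj` ≔ ★ p849928,
  `hbox` ≔ §3, `M` ≔ the box mass at `c`:  `Φ^st(endoTorus S c, f_H; m_H) · M(c) = stableSum S (chartOrbH ν_H S f_H) c` on `RegG S`, `M(c) > 0`.
HONEST LABEL: HC_CM is proved only modulo the 7 printed citations (2 remaining: hLiu418 = `stmt-HodgeConjecture-24832`, h413 = `stmt-HodgeConjecture-24833`) until rung 0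
closes; count-neutral plumbing for the skeleton's (READ) step.

## References
* [Rogawski1990] J. D. Rogawski, *Automorphic Representations of Unitary Groups in Three Variables*, Ann. of Math. Stud. 123 (1990), §1.7 p. 6 (measure conventions), §4.1
  p. 39, §4.3 (4.3.1) pp. 43–44 (compatible measures on the tori of a stable class), §8.2 p. 122.
* [Shelstad1979] D. Shelstad, *Characters and inner forms of a quasi-split group over ℝ*, Compositio Math. 39 (1979), §4 p. 20 (the measures `dt` on `T(ℝ)` transported
  along stable conjugacy), pp. 22–23.
* [LanglandsShelstad1987] R. P. Langlands, D. Shelstad, *On the definition of transfer factors*, Math. Ann. 278 (1987), §1.3–1.4.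
* [Folland1995] G. B. Folland, *A Course in Abstract Harmonic Analysis* (1995), §2.2 (uniqueness of Haar measure; automorphisms act by a modulus).
-/

set_option autoImplicit false

noncomputable section

open MeasureTheory MeasureTheory.Measure NumberField NumberField.InfinitePlace Matrix Complex Topology
open Literature.MeasureTheory.Group
open scoped MatrixGroups Matrix Classical NNReal ENNReal

/-! ## §1 One element of `GL₃(L ⊗ ℝ)` flips the whole chart -/

namespace Literature.NumberTheory.Automorphic.UnitaryGroup

open Literature.NumberTheory.Rogawski1990 Literature.NumberTheory.Automorphic.ArchCartan

section Local

variable (L : Type) [Field L] {S T : Finset {w : InfinitePlace L // IsComplex w}} {w : {w : InfinitePlace L // IsComplex w}}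

/-- `ι(g, 1) · ι(A, u) · ι(g, 1)⁻¹ = ι(g A g⁻¹, u)` (★ `endoGL` is a homomorphism). [cite: Rogawski1990, §4.8 p. 53] -/
theorem endoGL_conj_endoGL (g A : GL (Fin 2) ℂ) (u : GL (Fin 1) ℂ) :
    endoGL (g, (1 : GL (Fin 1) ℂ)) * endoGL (A, u) * (endoGL (g, (1 : GL (Fin 1) ℂ)))⁻¹ = endoGL (g * A * g⁻¹, u) := by
  rw [← map_mul, ← map_inv, ← map_mul, Prod.mk_mul_mk, Prod.inv_mk, Prod.mk_mul_mk, one_mul, inv_one, mul_one]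

/-- Outside the flipped places the `U(Φ₂)_w`-block of `flipSet T c` is that of `c`. [cite: Shelstad1979, §4 p. 23] -/
theorem endoBlock_flipSet_of_not_mem (hw : w ∉ T) (c : {w : InfinitePlace L // IsComplex w} → Fin 3 → ℝ) :
    endoBlock L S (flipSet T c) w = endoBlock L S c w := by
  apply Subtype.ext
  apply Units.ext
  by_cases hwS : w ∈ S
  · rw [coe_endoBlock_of_mem L _ hwS, coe_endoBlock_of_mem L _ hwS, flipSet_apply_of_not_mem hw]
  · rw [coe_endoBlock_of_not_mem L _ hwS, coe_endoBlock_of_not_mem L _ hwS, flipSet_apply_of_not_mem hw]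

/-- **FLIPPED PLACE, SIMULTANEOUS CONJUGATION**: at `w ∈ T` (`w ∉ S`) the ONE matrix `ι(P J P⁻¹, 1) ∈ GL₃(ℂ)` conjugates `ι(endoBlock S c w, endoCircle c w)` to
`ι(endoBlock S (flipSet T c) w, endoCircle (flipSet T c) w)` for EVERY `c` (★ `swapGL_conj_circleDiagonal`: `J diag(a,b) J⁻¹ = diag(b,a)`).
[cite: Rogawski1990, §8.2 p. 122; §3.1 p. 19] [cite: Shelstad1979, §4 p. 23] -/
theorem exists_forall_conj_endoGL_endoBlock_eq_flipSet_of_mem (hwS : w ∉ S) (hw : w ∈ T) :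
    ∃ u : GL (Fin 3) ℂ, ∀ c : {w : InfinitePlace L // IsComplex w} → Fin 3 → ℝ,
      u * endoGL (((endoBlock L S c w : ↥(archLocal L 2 (Matrix.of fun i j : Fin 2 => if i.val + j.val + 1 = 2 then (1 : L) else 0) w)) : GL (Fin 2) ℂ),
            ((endoCircle L c w : ↥(archLocal L 1 (Matrix.of fun i j : Fin 1 => if i.val + j.val + 1 = 1 then (1 : L) else 0) w)) : GL (Fin 1) ℂ)) * u⁻¹ =
        endoGL (((endoBlock L S (flipSet T c) w : ↥(archLocal L 2 (Matrix.of fun i j : Fin 2 => if i.val + j.val + 1 = 2 then (1 : L) else 0) w)) : GL (Fin 2) ℂ),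
            ((endoCircle L (flipSet T c) w : ↥(archLocal L 1 (Matrix.of fun i j : Fin 1 => if i.val + j.val + 1 = 1 then (1 : L) else 0) w)) : GL (Fin 1) ℂ)) := by
  refine ⟨endoGL (Matrix.GeneralLinearGroup.mkOfDetNeZero !![(1 : ℂ), 1; 1, -1] det_cayleyTwo_ne_zero *
      Matrix.GeneralLinearGroup.mkOfDetNeZero !![(0 : ℂ), 1; 1, 0] det_swapTwo_ne_zero *
      (Matrix.GeneralLinearGroup.mkOfDetNeZero !![(1 : ℂ), 1; 1, -1] det_cayleyTwo_ne_zero)⁻¹, (1 : GL (Fin 1) ℂ)), fun c => ?_⟩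
  rw [endoCircle_flipSet, endoGL_conj_endoGL, coe_endoBlock_eq_cayley_of_not_mem L S _ hwS, coe_endoBlock_eq_cayley_of_not_mem L S _ hwS, flipSet_apply_of_mem hw]
  have hJ := swapGL_conj_circleDiagonal ![Circle.exp (c w 0), Circle.exp (c w 2)]
  simp only [Matrix.cons_val_one, Matrix.cons_val_zero] at hJ
  have hconj : Matrix.GeneralLinearGroup.mkOfDetNeZero !![(1 : ℂ), 1; 1, -1] det_cayleyTwo_ne_zero *
        Matrix.GeneralLinearGroup.mkOfDetNeZero !![(0 : ℂ), 1; 1, 0] det_swapTwo_ne_zero *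
        (Matrix.GeneralLinearGroup.mkOfDetNeZero !![(1 : ℂ), 1; 1, -1] det_cayleyTwo_ne_zero)⁻¹ *
      (Matrix.GeneralLinearGroup.mkOfDetNeZero !![(1 : ℂ), 1; 1, -1] det_cayleyTwo_ne_zero * circleDiagonal 2 ![Circle.exp (c w 0), Circle.exp (c w 2)] *
        (Matrix.GeneralLinearGroup.mkOfDetNeZero !![(1 : ℂ), 1; 1, -1] det_cayleyTwo_ne_zero)⁻¹) *
      (Matrix.GeneralLinearGroup.mkOfDetNeZero !![(1 : ℂ), 1; 1, -1] det_cayleyTwo_ne_zero *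
        Matrix.GeneralLinearGroup.mkOfDetNeZero !![(0 : ℂ), 1; 1, 0] det_swapTwo_ne_zero *
        (Matrix.GeneralLinearGroup.mkOfDetNeZero !![(1 : ℂ), 1; 1, -1] det_cayleyTwo_ne_zero)⁻¹)⁻¹ =
      Matrix.GeneralLinearGroup.mkOfDetNeZero !![(1 : ℂ), 1; 1, -1] det_cayleyTwo_ne_zero * circleDiagonal 2 ![Circle.exp (c w 2), Circle.exp (c w 0)] *
        (Matrix.GeneralLinearGroup.mkOfDetNeZero !![(1 : ℂ), 1; 1, -1] det_cayleyTwo_ne_zero)⁻¹ := by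
    rw [← hJ]
    group
  rw [hconj]
  rfl

end Local

section Global

variable (L : Type) [Field L] [NumberField L] [IsCMField L] (S : Finset {w : InfinitePlace L // IsComplex w}) {T : Finset {w : InfinitePlace L // IsComplex w}}

/-- **SIMULTANEOUS FLIP CONJUGATION IN `GL₃(L ⊗ ℝ)`**: for `T ⊆ univ ∖ S` there is ONE `y ∈ GL₃(L ⊗ ℝ)` with `y · ι_∞(endoTorus S c) · y⁻¹ = ι_∞(endoTorus S (flipSet T c))`
for EVERY `c` (glue the place-wise conjugators of `exists_forall_conj_endoGL_endoBlock_eq_flipSet_of_mem` through ★ `GLnMixedPiEquiv`; the flip IS realised in `G(ℂ)`,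
though not in `H_∞`). [cite: Rogawski1990, §3.1 p. 19; §4.3 pp. 43–44] [cite: Shelstad1979, §4 pp. 22–23] -/
theorem exists_forall_conj_endoEmbArch_endoTorus_eq_flipSet (hT : ∀ w ∈ T, w ∉ S) :
    ∃ y : GL (Fin 3) (mixedEmbedding.mixedSpace L), ∀ c : {w : InfinitePlace L // IsComplex w} → Fin 3 → ℝ,
      y * ((endoEmbArch L (endoTorus L S c)).val : GL (Fin 3) (mixedEmbedding.mixedSpace L)) * y⁻¹ =
        ((endoEmbArch L (endoTorus L S (flipSet T c))).val : GL (Fin 3) (mixedEmbedding.mixedSpace L)) := by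
  have hplace : ∀ w : {w : InfinitePlace L // IsComplex w}, ∃ u : GL (Fin 3) ℂ, ∀ c : {w : InfinitePlace L // IsComplex w} → Fin 3 → ℝ,
      u * endoGL (((endoBlock L S c w : ↥(archLocal L 2 (Matrix.of fun i j : Fin 2 => if i.val + j.val + 1 = 2 then (1 : L) else 0) w)) : GL (Fin 2) ℂ),
            ((endoCircle L c w : ↥(archLocal L 1 (Matrix.of fun i j : Fin 1 => if i.val + j.val + 1 = 1 then (1 : L) else 0) w)) : GL (Fin 1) ℂ)) * u⁻¹ =
        endoGL (((endoBlock L S (flipSet T c) w : ↥(archLocal L 2 (Matrix.of fun i j : Fin 2 => if i.val + j.val + 1 = 2 then (1 : L) else 0) w)) : GL (Fin 2) ℂ),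
            ((endoCircle L (flipSet T c) w : ↥(archLocal L 1 (Matrix.of fun i j : Fin 1 => if i.val + j.val + 1 = 1 then (1 : L) else 0) w)) : GL (Fin 1) ℂ)) := by
    intro w
    by_cases hw : w ∈ T
    · exact exists_forall_conj_endoGL_endoBlock_eq_flipSet_of_mem L (hT w hw) hw
    · exact ⟨1, fun c => by rw [one_mul, inv_one, mul_one, endoBlock_flipSet_of_not_mem L hw, endoCircle_flipSet]⟩
  choose u hu using hplace
  refine ⟨(GLnMixedPiEquiv (↥(maximalRealSubfield L)) L (IsCMField.complexConj L) 3 (IsCMField.complexConj_ne_one L) (complexConj_smul_infinitePlace L)).symm u,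
    fun c => ?_⟩
  apply (GLnMixedPiEquiv (↥(maximalRealSubfield L)) L (IsCMField.complexConj L) 3 (IsCMField.complexConj_ne_one L) (complexConj_smul_infinitePlace L)).injective
  rw [map_mul, map_mul, map_inv, ContinuousMulEquiv.apply_symm_apply]
  funext w
  rw [Pi.mul_apply, Pi.mul_apply, Pi.inv_apply, GLnMixedPiEquiv_apply, GLnMixedPiEquiv_apply, map_evalC_endoEmbArch_endoTorus L S c w,
    map_evalC_endoEmbArch_endoTorus L S (flipSet T c) w]
  exact hu w c

end Global

end Literature.NumberTheory.Automorphic.UnitaryGroup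

/-! ## §2 The stable centraliser transport along a flip is «flip the coordinates» -/

namespace Literature.NumberTheory.Rogawski1990

open Literature.NumberTheory.Automorphic Literature.NumberTheory.Automorphic.UnitaryGroup Literature.NumberTheory.Automorphic.ArchCartan

section Transport

variable (L : Type) [Field L] [NumberField L] [IsCMField L] (S : Finset {w : InfinitePlace L // IsComplex w})
  (hd₃ : ((Matrix.of fun i j : Fin 3 => if i.val + j.val + 1 = 3 then (1 : L) else 0) : Matrix (Fin 3) (Fin 3) L).det ≠ 0)
  {c : {w : InfinitePlace L // IsComplex w} → Fin 3 → ℝ} {T : Finset {w : InfinitePlace L // IsComplex w}}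
  (hT : ∀ w ∈ T, w ∉ S) (hreg : IsArchGRegular L (endoTorus L S c))

/-- **THE FLIP TRANSPORT ON CHART POINTS**: for `T ⊆ univ ∖ S`, the stable centraliser transport `e : Z_{G_∞}(ι γ) ≃ₜ* Z_{G_∞}(ι γ_T)` (`γ = endoTorus S c` `G`-regular,
`γ_T` its flip) composed with `ι_∞|_{Z(γ)}` sends `z` with `↑z = endoTorus S c₀` to `ι_∞(endoTorus S (flipSet T c₀))` — for EVERY `c₀` (★ `coe_archStableCentralizerEquiv_eq_of_conj_eq`
with the coordinate-free conjugator of §1). [cite: Rogawski1990, §4.3 pp. 43–44] [cite: Shelstad1979, §4 p. 20] [cite: LanglandsShelstad1987, §1.3–1.4] -/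
theorem coe_archStableCentralizerEquiv_endoEmbArchCentralizer_flipSet_of_coe_eq
    (z : Subgroup.centralizer ({endoTorus L S c} : Set (↥(arch (↥(maximalRealSubfield L)) L (IsCMField.complexConj L) 2 (Matrix.of fun i j : Fin 2 => if i.val + j.val + 1 = 2 then (1 : L) else 0)) × ↥(arch (↥(maximalRealSubfield L)) L (IsCMField.complexConj L) 1 (Matrix.of fun i j : Fin 1 => if i.val + j.val + 1 = 1 then (1 : L) else 0)))))
    {c₀ : {w : InfinitePlace L // IsComplex w} → Fin 3 → ℝ}
    (hz : (z : ↥(arch (↥(maximalRealSubfield L)) L (IsCMField.complexConj L) 2 (Matrix.of fun i j : Fin 2 => if i.val + j.val + 1 = 2 then (1 : L) else 0)) × ↥(arch (↥(maximalRealSubfield L)) L (IsCMField.complexConj L) 1 (Matrix.of fun i j : Fin 1 => if i.val + j.val + 1 = 1 then (1 : L) else 0))) = endoTorus L S c₀) :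
    (archStableCentralizerEquiv L hd₃ hd₃ ((isArchStablyConjH_endoTorus_flipSet L S hT c).corresponds_endoEmbArch L) (hreg.isRegularElt_endoEmbArch L)
        (endoEmbArchCentralizer L (endoTorus L S c) z) :
          ↥(arch (↥(maximalRealSubfield L)) L (IsCMField.complexConj L) 3 (Matrix.of fun i j : Fin 3 => if i.val + j.val + 1 = 3 then (1 : L) else 0))) =
      endoEmbArch L (endoTorus L S (flipSet T c₀)) := by
  obtain ⟨y, hy⟩ := exists_forall_conj_endoEmbArch_endoTorus_eq_flipSet L S hT
  apply Subtype.ext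
  rw [coe_archStableCentralizerEquiv_eq_of_conj_eq L hd₃ hd₃ ((isArchStablyConjH_endoTorus_flipSet L S hT c).corresponds_endoEmbArch L) (hreg.isRegularElt_endoEmbArch L) y (hy c),
    coe_endoEmbArchCentralizer, hz]
  exact hy c₀

/-- **The flip transport read back in `H_∞`**: with `ι_∞|_Z` promoted to topological-group isomorphisms `eZ`, `eZT` at the two `G`-regular points (★
`exists_continuousMulEquiv_coe_eq_endoEmbArchCentralizer`), the composite `eZT⁻¹ ∘ e ∘ eZ : Z(γ) → Z(γ_T)` sends the chart point `endoTorus S c₀` to `endoTorus S (flipSet T c₀)`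
(`ι_∞` is injective). [cite: Rogawski1990, §4.3 pp. 43–44; §4.8 p. 53] [cite: Shelstad1979, §4 p. 20] -/
theorem coe_symm_archStableCentralizerEquiv_flipSet_of_coe_eq
    (eZ : ↥(Subgroup.centralizer ({endoTorus L S c} : Set (↥(arch (↥(maximalRealSubfield L)) L (IsCMField.complexConj L) 2 (Matrix.of fun i j : Fin 2 => if i.val + j.val + 1 = 2 then (1 : L) else 0)) × ↥(arch (↥(maximalRealSubfield L)) L (IsCMField.complexConj L) 1 (Matrix.of fun i j : Fin 1 => if i.val + j.val + 1 = 1 then (1 : L) else 0))))) ≃ₜ* ↥(Subgroup.centralizer ({endoEmbArch L (endoTorus L S c)} : Set ↥(arch (↥(maximalRealSubfield L)) L (IsCMField.complexConj L) 3 (Matrix.of fun i j : Fin 3 => if i.val + j.val + 1 = 3 then (1 : L) else 0)))))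
    (heZ : ⇑eZ = ⇑(endoEmbArchCentralizer L (endoTorus L S c)))
    (eZT : ↥(Subgroup.centralizer ({endoTorus L S (flipSet T c)} : Set (↥(arch (↥(maximalRealSubfield L)) L (IsCMField.complexConj L) 2 (Matrix.of fun i j : Fin 2 => if i.val + j.val + 1 = 2 then (1 : L) else 0)) × ↥(arch (↥(maximalRealSubfield L)) L (IsCMField.complexConj L) 1 (Matrix.of fun i j : Fin 1 => if i.val + j.val + 1 = 1 then (1 : L) else 0))))) ≃ₜ* ↥(Subgroup.centralizer ({endoEmbArch L (endoTorus L S (flipSet T c))} : Set ↥(arch (↥(maximalRealSubfield L)) L (IsCMField.complexConj L) 3 (Matrix.of fun i j : Fin 3 => if i.val + j.val + 1 = 3 then (1 : L) else 0)))))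
    (heZT : ⇑eZT = ⇑(endoEmbArchCentralizer L (endoTorus L S (flipSet T c))))
    (z : ↥(Subgroup.centralizer ({endoTorus L S c} : Set (↥(arch (↥(maximalRealSubfield L)) L (IsCMField.complexConj L) 2 (Matrix.of fun i j : Fin 2 => if i.val + j.val + 1 = 2 then (1 : L) else 0)) × ↥(arch (↥(maximalRealSubfield L)) L (IsCMField.complexConj L) 1 (Matrix.of fun i j : Fin 1 => if i.val + j.val + 1 = 1 then (1 : L) else 0)))))) {c₀ : {w : InfinitePlace L // IsComplex w} → Fin 3 → ℝ}
    (hz : (z : (↥(arch (↥(maximalRealSubfield L)) L (IsCMField.complexConj L) 2 (Matrix.of fun i j : Fin 2 => if i.val + j.val + 1 = 2 then (1 : L) else 0)) × ↥(arch (↥(maximalRealSubfield L)) L (IsCMField.complexConj L) 1 (Matrix.of fun i j : Fin 1 => if i.val + j.val + 1 = 1 then (1 : L) else 0)))) = endoTorus L S c₀) :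
    ((eZT.symm (archStableCentralizerEquiv L hd₃ hd₃ ((isArchStablyConjH_endoTorus_flipSet L S hT c).corresponds_endoEmbArch L) (hreg.isRegularElt_endoEmbArch L) (eZ z)) : ↥(Subgroup.centralizer ({endoTorus L S (flipSet T c)} : Set (↥(arch (↥(maximalRealSubfield L)) L (IsCMField.complexConj L) 2 (Matrix.of fun i j : Fin 2 => if i.val + j.val + 1 = 2 then (1 : L) else 0)) × ↥(arch (↥(maximalRealSubfield L)) L (IsCMField.complexConj L) 1 (Matrix.of fun i j : Fin 1 => if i.val + j.val + 1 = 1 then (1 : L) else 0)))))) : (↥(arch (↥(maximalRealSubfield L)) L (IsCMField.complexConj L) 2 (Matrix.of fun i j : Fin 2 => if i.val + j.val + 1 = 2 then (1 : L) else 0)) × ↥(arch (↥(maximalRealSubfield L)) L (IsCMField.complexConj L) 1 (Matrix.of fun i j : Fin 1 => if i.val + j.val + 1 = 1 then (1 : L) else 0)))) =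
      endoTorus L S (flipSet T c₀) := by
  have h1 : (endoEmbArchCentralizer L (endoTorus L S (flipSet T c)) (eZT.symm (archStableCentralizerEquiv L hd₃ hd₃ ((isArchStablyConjH_endoTorus_flipSet L S hT c).corresponds_endoEmbArch L) (hreg.isRegularElt_endoEmbArch L) (eZ z))) : ↥(arch (↥(maximalRealSubfield L)) L (IsCMField.complexConj L) 3 (Matrix.of fun i j : Fin 3 => if i.val + j.val + 1 = 3 then (1 : L) else 0))) = (archStableCentralizerEquiv L hd₃ hd₃ ((isArchStablyConjH_endoTorus_flipSet L S hT c).corresponds_endoEmbArch L) (hreg.isRegularElt_endoEmbArch L) (eZ z) : ↥(arch (↥(maximalRealSubfield L)) L (IsCMField.complexConj L) 3 (Matrix.of fun i j : Fin 3 => if i.val + j.val + 1 = 3 then (1 : L) else 0))) := by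
    have h := eZT.apply_symm_apply (archStableCentralizerEquiv L hd₃ hd₃ ((isArchStablyConjH_endoTorus_flipSet L S hT c).corresponds_endoEmbArch L) (hreg.isRegularElt_endoEmbArch L) (eZ z))
    rw [heZT] at h
    rw [h]
  have h2 : ((archStableCentralizerEquiv L hd₃ hd₃ ((isArchStablyConjH_endoTorus_flipSet L S hT c).corresponds_endoEmbArch L) (hreg.isRegularElt_endoEmbArch L) (eZ z)) : ↥(arch (↥(maximalRealSubfield L)) L (IsCMField.complexConj L) 3 (Matrix.of fun i j : Fin 3 => if i.val + j.val + 1 = 3 then (1 : L) else 0))) = endoEmbArch L (endoTorus L S (flipSet T c₀)) := by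
    have h : eZ z = endoEmbArchCentralizer L (endoTorus L S c) z := by rw [heZ]
    rw [h]
    exact coe_archStableCentralizerEquiv_endoEmbArchCentralizer_flipSet_of_coe_eq L S hd₃ hT hreg z hz
  have h3 : endoEmbArch L ((eZT.symm (archStableCentralizerEquiv L hd₃ hd₃ ((isArchStablyConjH_endoTorus_flipSet L S hT c).corresponds_endoEmbArch L) (hreg.isRegularElt_endoEmbArch L) (eZ z))) : (↥(arch (↥(maximalRealSubfield L)) L (IsCMField.complexConj L) 2 (Matrix.of fun i j : Fin 2 => if i.val + j.val + 1 = 2 then (1 : L) else 0)) × ↥(arch (↥(maximalRealSubfield L)) L (IsCMField.complexConj L) 1 (Matrix.of fun i j : Fin 1 => if i.val + j.val + 1 = 1 then (1 : L) else 0)))) = endoEmbArch L (endoTorus L S (flipSet T c₀)) := by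
    rw [← coe_endoEmbArchCentralizer, h1, h2]
  exact endoEmbArch_injective L h3

end Transport

/-! ## §3a The abstract transport chain: an involutive composite of measure-carrying isomorphisms fixes a Haar measure -/

section Abstract

/-- **ABSTRACT TRANSPORT CHAIN.**  Groups `T_S`, `Z_H, Z_H′` (two presentations `sc₀ : T_S ≃ Z_H`, `sc_T : T_S ≃ Z_H′`), `Z_G, Z_G′` with isomorphisms `eZ : Z_H ≃ Z_G`,
`eZT : Z_H′ ≃ Z_G′`, `e : Z_G ≃ Z_G′` carrying `t_H ↦ t`, `t_H′ ↦ t′`, `t ↦ t′`; if `t_H` is a Haar measure and the composite `T_S → T_S` is an INVOLUTION, then `t_H′`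
and `t_H` agree on `T_S` (★ (β) `map_eq_self_of_involutive`: an involutive automorphism has modulus `1`).  Small types on purpose: the frame instance (§3b) only has to
supply the hypotheses. [cite: Folland1995, §2.2] [cite: Rogawski1990, §4.3 (4.3.1) p. 43] -/
theorem map_symm_eq_map_symm_of_transport_chain
    {TS ZH ZHT ZG ZGT : Type*}
    [Group TS] [TopologicalSpace TS] [IsTopologicalGroup TS] [LocallyCompactSpace TS] [SecondCountableTopology TS] [MeasurableSpace TS] [BorelSpace TS]
    [Group ZH] [TopologicalSpace ZH] [IsTopologicalGroup ZH] [MeasurableSpace ZH] [BorelSpace ZH]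
    [Group ZHT] [TopologicalSpace ZHT] [MeasurableSpace ZHT] [BorelSpace ZHT]
    [Group ZG] [TopologicalSpace ZG] [MeasurableSpace ZG] [BorelSpace ZG]
    [Group ZGT] [TopologicalSpace ZGT] [MeasurableSpace ZGT] [BorelSpace ZGT]
    (sc₀ : TS ≃* ZH) (hsc₀ : Continuous sc₀) (hsc₀s : Continuous sc₀.symm)
    (scT : TS ≃* ZHT) (hscT : Continuous scT) (hscTs : Continuous scT.symm)
    (eZ : ZH ≃ₜ* ZG) (eZT : ZHT ≃ₜ* ZGT) (e : ZG ≃ₜ* ZGT)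
    (tH₀ : Measure ZH) [tH₀.IsHaarMeasure] (tHT : Measure ZHT) (t₀ : Measure ZG) (tT : Measure ZGT)
    (hA : Measure.map ⇑eZT tHT = tT) (hB : Measure.map ⇑e t₀ = tT) (hC : Measure.map ⇑eZ tH₀ = t₀)
    (hinv : ∀ x, scT.symm (eZT.symm (e (eZ (sc₀ (scT.symm (eZT.symm (e (eZ (sc₀ x))))))))) = x) :
    Measure.map ⇑scT.symm tHT = Measure.map ⇑sc₀.symm tH₀ := by
  have mZ : Measurable ⇑eZ := eZ.continuous.measurable
  have mZT : Measurable ⇑eZT := eZT.continuous.measurable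
  have mZTs : Measurable ⇑eZT.symm := eZT.symm.continuous.measurable
  have me : Measurable ⇑e := e.continuous.measurable
  have hsymm : (⇑eZT.symm ∘ ⇑eZT) = id := funext fun x => eZT.symm_apply_apply x
  have hD : tHT = Measure.map (⇑eZT.symm ∘ (⇑e ∘ ⇑eZ)) tH₀ := by
    rw [← Measure.map_map mZTs (me.comp mZ), ← Measure.map_map me mZ, hC, hB, ← hA, Measure.map_map mZTs mZT, hsymm, Measure.map_id]
  have hsymm₀ : (⇑sc₀ ∘ ⇑sc₀.symm) = id := funext fun x => sc₀.apply_symm_apply x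
  have hμ : Measure.map ⇑sc₀ (Measure.map ⇑sc₀.symm tH₀) = tH₀ := by
    rw [Measure.map_map hsc₀.measurable hsc₀s.measurable, hsymm₀, Measure.map_id]
  let Ψ : TS ≃* TS := sc₀.trans (eZ.toMulEquiv.trans (e.toMulEquiv.trans (eZT.toMulEquiv.symm.trans scT.symm)))
  have hΨcoe : ⇑Ψ = ⇑scT.symm ∘ ((⇑eZT.symm ∘ (⇑e ∘ ⇑eZ)) ∘ ⇑sc₀) := rfl
  have hΨc : Continuous Ψ := by
    rw [hΨcoe]; exact hscTs.comp ((eZT.symm.continuous.comp (e.continuous.comp eZ.continuous)).comp hsc₀)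
  have hΨsc : Continuous Ψ.symm := by
    show Continuous (fun x => sc₀.symm (eZ.symm (e.symm (eZT (scT x)))))
    exact hsc₀s.comp (eZ.symm.continuous.comp (e.symm.continuous.comp (eZT.continuous.comp hscT)))
  have hinv' : ∀ x, Ψ (Ψ x) = x := fun x => hinv x
  haveI : (Measure.map ⇑sc₀.symm tH₀).IsHaarMeasure := sc₀.symm.isHaarMeasure_map tH₀ hsc₀s hsc₀
  have key := map_eq_self_of_involutive Ψ hΨc hΨsc hinv' (Measure.map ⇑sc₀.symm tH₀)
  calc Measure.map ⇑scT.symm tHT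
      = Measure.map ⇑scT.symm (Measure.map (⇑eZT.symm ∘ (⇑e ∘ ⇑eZ)) (Measure.map ⇑sc₀ (Measure.map ⇑sc₀.symm tH₀))) := by rw [hμ, ← hD]
    _ = Measure.map ⇑Ψ (Measure.map ⇑sc₀.symm tH₀) := by
        rw [Measure.map_map (mZTs.comp (me.comp mZ)) hsc₀.measurable, Measure.map_map hscTs.measurable ((mZTs.comp (me.comp mZ)).comp hsc₀.measurable), hΨcoe]
    _ = Measure.map ⇑sc₀.symm tH₀ := key

end Abstract

/-! ## §3 In a compatible frame the torus measures at `γ` and at its flips coincide on `T_S` -/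

section Frame

variable (L : Type) [Field L] [NumberField L] [IsCMField L]
  [MeasurableSpace ↥(arch (↥(maximalRealSubfield L)) L (IsCMField.complexConj L) 3 (Matrix.of fun i j : Fin 3 => if i.val + j.val + 1 = 3 then (1 : L) else 0))] [BorelSpace ↥(arch (↥(maximalRealSubfield L)) L (IsCMField.complexConj L) 3 (Matrix.of fun i j : Fin 3 => if i.val + j.val + 1 = 3 then (1 : L) else 0))]
  [MeasurableSpace (↥(arch (↥(maximalRealSubfield L)) L (IsCMField.complexConj L) 2 (Matrix.of fun i j : Fin 2 => if i.val + j.val + 1 = 2 then (1 : L) else 0)) × ↥(arch (↥(maximalRealSubfield L)) L (IsCMField.complexConj L) 1 (Matrix.of fun i j : Fin 1 => if i.val + j.val + 1 = 1 then (1 : L) else 0)))] [BorelSpace (↥(arch (↥(maximalRealSubfield L)) L (IsCMField.complexConj L) 2 (Matrix.of fun i j : Fin 2 => if i.val + j.val + 1 = 2 then (1 : L) else 0)) × ↥(arch (↥(maximalRealSubfield L)) L (IsCMField.complexConj L) 1 (Matrix.of fun i j : Fin 1 => if i.val + j.val + 1 = 1 then (1 : L) else 0)))]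
  (t : ∀ γ : ↥(arch (↥(maximalRealSubfield L)) L (IsCMField.complexConj L) 3 (Matrix.of fun i j : Fin 3 => if i.val + j.val + 1 = 3 then (1 : L) else 0)), Measure (Subgroup.centralizer ({γ} : Set ↥(arch (↥(maximalRealSubfield L)) L (IsCMField.complexConj L) 3 (Matrix.of fun i j : Fin 3 => if i.val + j.val + 1 = 3 then (1 : L) else 0)))))
  (tH : ∀ γH : (↥(arch (↥(maximalRealSubfield L)) L (IsCMField.complexConj L) 2 (Matrix.of fun i j : Fin 2 => if i.val + j.val + 1 = 2 then (1 : L) else 0)) × ↥(arch (↥(maximalRealSubfield L)) L (IsCMField.complexConj L) 1 (Matrix.of fun i j : Fin 1 => if i.val + j.val + 1 = 1 then (1 : L) else 0))), Measure (Subgroup.centralizer ({γH} : Set (↥(arch (↥(maximalRealSubfield L)) L (IsCMField.complexConj L) 2 (Matrix.of fun i j : Fin 2 => if i.val + j.val + 1 = 2 then (1 : L) else 0)) × ↥(arch (↥(maximalRealSubfield L)) L (IsCMField.complexConj L) 1 (Matrix.of fun i j : Fin 1 => if i.val + j.val + 1 = 1 then (1 : L) else 0))))))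
  (hd₃ : ((Matrix.of fun i j : Fin 3 => if i.val + j.val + 1 = 3 then (1 : L) else 0) : Matrix (Fin 3) (Fin 3) L).det ≠ 0)
  (hC : ∀ (γ₁ γ₂ : ↥(arch (↥(maximalRealSubfield L)) L (IsCMField.complexConj L) 3 (Matrix.of fun i j : Fin 3 => if i.val + j.val + 1 = 3 then (1 : L) else 0))) (h₁ : IsRegularElt (γ₁.val : GL (Fin 3) (mixedEmbedding.mixedSpace L)))
      (hc : Corresponds (UnitaryGroup.conjMixed (↥(maximalRealSubfield L)) L (IsCMField.complexConj L))
        (UnitaryGroup.archFormOf L 3 (Matrix.of fun i j : Fin 3 => if i.val + j.val + 1 = 3 then (1 : L) else 0))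
        (UnitaryGroup.archFormOf L 3 (Matrix.of fun i j : Fin 3 => if i.val + j.val + 1 = 3 then (1 : L) else 0)) γ₁ γ₂),
      Measure.map ⇑(UnitaryGroup.archStableCentralizerEquiv L hd₃ hd₃ hc h₁) (t γ₁) = t γ₂)
  (hCH : ∀ γH : (↥(arch (↥(maximalRealSubfield L)) L (IsCMField.complexConj L) 2 (Matrix.of fun i j : Fin 2 => if i.val + j.val + 1 = 2 then (1 : L) else 0)) × ↥(arch (↥(maximalRealSubfield L)) L (IsCMField.complexConj L) 1 (Matrix.of fun i j : Fin 1 => if i.val + j.val + 1 = 1 then (1 : L) else 0))), IsArchGRegular L γH → Measure.map ⇑(endoEmbArchCentralizer L γH) (tH γH) = t (endoEmbArch L γH))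
  [qHH : ∀ a : (↥(arch (↥(maximalRealSubfield L)) L (IsCMField.complexConj L) 2 (Matrix.of fun i j : Fin 2 => if i.val + j.val + 1 = 2 then (1 : L) else 0)) × ↥(arch (↥(maximalRealSubfield L)) L (IsCMField.complexConj L) 1 (Matrix.of fun i j : Fin 1 => if i.val + j.val + 1 = 1 then (1 : L) else 0))), MeasurableSpace ((↥(arch (↥(maximalRealSubfield L)) L (IsCMField.complexConj L) 2 (Matrix.of fun i j : Fin 2 => if i.val + j.val + 1 = 2 then (1 : L) else 0)) × ↥(arch (↥(maximalRealSubfield L)) L (IsCMField.complexConj L) 1 (Matrix.of fun i j : Fin 1 => if i.val + j.val + 1 = 1 then (1 : L) else 0))) ⧸ Subgroup.centralizer ({a} : Set (↥(arch (↥(maximalRealSubfield L)) L (IsCMField.complexConj L) 2 (Matrix.of fun i j : Fin 2 => if i.val + j.val + 1 = 2 then (1 : L) else 0)) × ↥(arch (↥(maximalRealSubfield L)) L (IsCMField.complexConj L) 1 (Matrix.of fun i j : Fin 1 => if i.val + j.val + 1 = 1 then (1 : L) else 0)))))]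
  [qbHH : ∀ a : (↥(arch (↥(maximalRealSubfield L)) L (IsCMField.complexConj L) 2 (Matrix.of fun i j : Fin 2 => if i.val + j.val + 1 = 2 then (1 : L) else 0)) × ↥(arch (↥(maximalRealSubfield L)) L (IsCMField.complexConj L) 1 (Matrix.of fun i j : Fin 1 => if i.val + j.val + 1 = 1 then (1 : L) else 0))), BorelSpace ((↥(arch (↥(maximalRealSubfield L)) L (IsCMField.complexConj L) 2 (Matrix.of fun i j : Fin 2 => if i.val + j.val + 1 = 2 then (1 : L) else 0)) × ↥(arch (↥(maximalRealSubfield L)) L (IsCMField.complexConj L) 1 (Matrix.of fun i j : Fin 1 => if i.val + j.val + 1 = 1 then (1 : L) else 0))) ⧸ Subgroup.centralizer ({a} : Set (↥(arch (↥(maximalRealSubfield L)) L (IsCMField.complexConj L) 2 (Matrix.of fun i j : Fin 2 => if i.val + j.val + 1 = 2 then (1 : L) else 0)) × ↥(arch (↥(maximalRealSubfield L)) L (IsCMField.complexConj L) 1 (Matrix.of fun i j : Fin 1 => if i.val + j.val + 1 = 1 then (1 : L) else 0)))))]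
  (νH : Measure (↥(arch (↥(maximalRealSubfield L)) L (IsCMField.complexConj L) 2 (Matrix.of fun i j : Fin 2 => if i.val + j.val + 1 = 2 then (1 : L) else 0)) × ↥(arch (↥(maximalRealSubfield L)) L (IsCMField.complexConj L) 1 (Matrix.of fun i j : Fin 1 => if i.val + j.val + 1 = 1 then (1 : L) else 0)))) [νH.IsHaarMeasure] [νH.IsMulRightInvariant]
  (mH : OrbitalMeasureFamily (↥(arch (↥(maximalRealSubfield L)) L (IsCMField.complexConj L) 2 (Matrix.of fun i j : Fin 2 => if i.val + j.val + 1 = 2 then (1 : L) else 0)) × ↥(arch (↥(maximalRealSubfield L)) L (IsCMField.complexConj L) 1 (Matrix.of fun i j : Fin 1 => if i.val + j.val + 1 = 1 then (1 : L) else 0))))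
  (hWH : mH.IsQuotientOf (IsArchGRegular L) νH tH)

include hC hCH hWH in
/-- **BOX COHERENCE ACROSS THE FLIPS (the `hbox` of R4), in measure form.**  In a frame in print's measure convention ((W_H)+(C_H)+(C)), for `c ∈ RegG S` and a flip
`T ⊆ univ ∖ S`, the torus measures `t_H(endoTorus S (flipSet T c))` and `t_H(endoTorus S c)`, read on the common centraliser `T_S` through the two presentations, ARE EQUAL:
(C_H) at both points and (C) along `ι γ ↔ ι γ_T` make the first the push-forward of the second under the flip automorphism `Ψ` of `T_S` (§2), a continuous involution;
`t_H(γ)` is a Haar measure on `Z(γ)` (★ `atPoint_eq_quotientMeasure_tH_of_isArchGRegular`), and involutive automorphisms preserve Haar measures (★ (β)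
`map_eq_self_of_involutive`). [cite: Rogawski1990, §1.7 p. 6; §4.3 (4.3.1) pp. 43–44] [cite: Shelstad1979, §4 p. 20] [cite: LanglandsShelstad1987, §1.3–1.4] [cite: Folland1995, §2.2] -/
theorem map_subgroupCongr_symm_tH_endoTorus_flipSet_eq (S : Finset {w : InfinitePlace L // IsComplex w})
    {c : {w : InfinitePlace L // IsComplex w} → Fin 3 → ℝ} (hc : c ∈ ArchCartan.RegG S) {T : Finset {w : InfinitePlace L // IsComplex w}} (hTm : T ∈ (Finset.univ \ S).powerset)
    (hP₀ : chartTorusH L S = Subgroup.centralizer ({endoTorus L S c} : Set (↥(arch (↥(maximalRealSubfield L)) L (IsCMField.complexConj L) 2 (Matrix.of fun i j : Fin 2 => if i.val + j.val + 1 = 2 then (1 : L) else 0)) × ↥(arch (↥(maximalRealSubfield L)) L (IsCMField.complexConj L) 1 (Matrix.of fun i j : Fin 1 => if i.val + j.val + 1 = 1 then (1 : L) else 0)))))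
    (hP : chartTorusH L S = Subgroup.centralizer ({endoTorus L S (flipSet T c)} : Set (↥(arch (↥(maximalRealSubfield L)) L (IsCMField.complexConj L) 2 (Matrix.of fun i j : Fin 2 => if i.val + j.val + 1 = 2 then (1 : L) else 0)) × ↥(arch (↥(maximalRealSubfield L)) L (IsCMField.complexConj L) 1 (Matrix.of fun i j : Fin 1 => if i.val + j.val + 1 = 1 then (1 : L) else 0))))) :
    (tH (endoTorus L S (flipSet T c))).map ⇑(MulEquiv.subgroupCongr hP).symm = (tH (endoTorus L S c)).map ⇑(MulEquiv.subgroupCongr hP₀).symm := by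
  have hT : ∀ w ∈ T, w ∉ S := not_mem_of_mem_powerset_sdiff hTm
  have hreg : IsArchGRegular L (endoTorus L S c) := (isArchGRegular_endoTorus_iff_mem_regG L S c).2 hc
  have hregT : IsArchGRegular L (endoTorus L S (flipSet T c)) := (isArchGRegular_endoTorus_iff_mem_regG L S _).2 (flipSet_mem_regG S hT hc)
  have hst : IsArchStablyConjH L (endoTorus L S c) (endoTorus L S (flipSet T c)) := isArchStablyConjH_endoTorus_flipSet L S hT c
  -- `t_H(γ)` is a Haar measure (frame)
  obtain ⟨iH, -, -⟩ := atPoint_eq_quotientMeasure_tH_of_isArchGRegular L t tH hd₃ hC hCH νH mH hWH (endoTorus L S c) hreg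
  haveI := iH
  haveI := locallyCompactSpace_chartTorusH L S
  -- `ι_∞|_Z` as topological-group isomorphisms at the two `G`-regular points
  obtain ⟨eZ, heZ⟩ := exists_continuousMulEquiv_coe_eq_endoEmbArchCentralizer L hreg
  obtain ⟨eZT, heZT⟩ := exists_continuousMulEquiv_coe_eq_endoEmbArchCentralizer L hregT
  have csc₀ : Continuous ⇑(MulEquiv.subgroupCongr hP₀) := continuous_subtype_val.subtype_mk _
  have csc₀s : Continuous ⇑(MulEquiv.subgroupCongr hP₀).symm := continuous_subtype_val.subtype_mk _
  have csc : Continuous ⇑(MulEquiv.subgroupCongr hP) := continuous_subtype_val.subtype_mk _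
  have cscs : Continuous ⇑(MulEquiv.subgroupCongr hP).symm := continuous_subtype_val.subtype_mk _
  -- (C_H) at both points, (C) between them
  have hA : Measure.map ⇑eZT (tH (endoTorus L S (flipSet T c))) = t (endoEmbArch L (endoTorus L S (flipSet T c))) := by
    rw [heZT]; exact hCH _ hregT
  have hB : Measure.map ⇑(archStableCentralizerEquiv L hd₃ hd₃ ((isArchStablyConjH_endoTorus_flipSet L S hT c).corresponds_endoEmbArch L) (hreg.isRegularElt_endoEmbArch L)) (t (endoEmbArch L (endoTorus L S c))) = t (endoEmbArch L (endoTorus L S (flipSet T c))) :=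
    hC _ _ (hreg.isRegularElt_endoEmbArch L) (hst.corresponds_endoEmbArch L)
  have hC' : Measure.map ⇑eZ (tH (endoTorus L S c)) = t (endoEmbArch L (endoTorus L S c)) := by
    rw [heZ]; exact hCH _ hreg
  -- the composite is the flip of `T_S`, an involution
  have hinv : ∀ x : ↥(chartTorusH L S), (MulEquiv.subgroupCongr hP).symm (eZT.symm (archStableCentralizerEquiv L hd₃ hd₃ ((isArchStablyConjH_endoTorus_flipSet L S hT c).corresponds_endoEmbArch L) (hreg.isRegularElt_endoEmbArch L) (eZ (MulEquiv.subgroupCongr hP₀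
      ((MulEquiv.subgroupCongr hP).symm (eZT.symm (archStableCentralizerEquiv L hd₃ hd₃ ((isArchStablyConjH_endoTorus_flipSet L S hT c).corresponds_endoEmbArch L) (hreg.isRegularElt_endoEmbArch L) (eZ (MulEquiv.subgroupCongr hP₀ x))))))))) = x := by
    intro x
    obtain ⟨c₀, hc₀⟩ := (mem_chartTorusH_iff L S (x : (↥(arch (↥(maximalRealSubfield L)) L (IsCMField.complexConj L) 2 (Matrix.of fun i j : Fin 2 => if i.val + j.val + 1 = 2 then (1 : L) else 0)) × ↥(arch (↥(maximalRealSubfield L)) L (IsCMField.complexConj L) 1 (Matrix.of fun i j : Fin 1 => if i.val + j.val + 1 = 1 then (1 : L) else 0))))).1 x.2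
    have s1 := coe_symm_archStableCentralizerEquiv_flipSet_of_coe_eq L S hd₃ hT hreg eZ heZ eZT heZT (MulEquiv.subgroupCongr hP₀ x)
      (c₀ := c₀) (by rw [MulEquiv.subgroupCongr_apply]; exact hc₀.symm)
    have s2 := coe_symm_archStableCentralizerEquiv_flipSet_of_coe_eq L S hd₃ hT hreg eZ heZ eZT heZT
      (MulEquiv.subgroupCongr hP₀ ((MulEquiv.subgroupCongr hP).symm (eZT.symm (archStableCentralizerEquiv L hd₃ hd₃ ((isArchStablyConjH_endoTorus_flipSet L S hT c).corresponds_endoEmbArch L) (hreg.isRegularElt_endoEmbArch L) (eZ (MulEquiv.subgroupCongr hP₀ x))))))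
      (c₀ := flipSet T c₀) (by rw [MulEquiv.subgroupCongr_apply, MulEquiv.subgroupCongr_symm_apply]; exact s1)
    apply Subtype.ext
    rw [MulEquiv.subgroupCongr_symm_apply, s2, flipSet_flipSet, hc₀]
  exact map_symm_eq_map_symm_of_transport_chain (MulEquiv.subgroupCongr hP₀) csc₀ csc₀s (MulEquiv.subgroupCongr hP) csc cscs eZ eZT
    (archStableCentralizerEquiv L hd₃ hd₃ ((isArchStablyConjH_endoTorus_flipSet L S hT c).corresponds_endoEmbArch L) (hreg.isRegularElt_endoEmbArch L)) (tH (endoTorus L S c)) (tH (endoTorus L S (flipSet T c)))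
    (t (endoEmbArch L (endoTorus L S c))) (t (endoEmbArch L (endoTorus L S (flipSet T c)))) hA hB hC' hinv

include hC hCH hWH in
/-- **The `hbox` of R4, discharged**: the frame mass of the chart box is the same number at every flip point — namely the mass `M(c)` at `c` itself.
[cite: Rogawski1990, §4.3 (4.3.1) pp. 43–44] [cite: Shelstad1979, §4 p. 20] -/
theorem toReal_map_tH_endoTorus_flipSet_chartBoxImg_eq (S : Finset {w : InfinitePlace L // IsComplex w})
    {c : {w : InfinitePlace L // IsComplex w} → Fin 3 → ℝ} (hc : c ∈ ArchCartan.RegG S) {T : Finset {w : InfinitePlace L // IsComplex w}} (hTm : T ∈ (Finset.univ \ S).powerset)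
    (hP : chartTorusH L S = Subgroup.centralizer ({endoTorus L S (flipSet T c)} : Set (↥(arch (↥(maximalRealSubfield L)) L (IsCMField.complexConj L) 2 (Matrix.of fun i j : Fin 2 => if i.val + j.val + 1 = 2 then (1 : L) else 0)) × ↥(arch (↥(maximalRealSubfield L)) L (IsCMField.complexConj L) 1 (Matrix.of fun i j : Fin 1 => if i.val + j.val + 1 = 1 then (1 : L) else 0))))) :
    ((tH (endoTorus L S (flipSet T c))).map ⇑(MulEquiv.subgroupCongr hP).symm (chartBoxImg L S)).toReal =
      ((tH (endoTorus L S c)).map ⇑(MulEquiv.subgroupCongr (chartTorusH_eq_centralizer_of_mem_regS L S (ArchCartan.regG_subset_regS S hc))).symm (chartBoxImg L S)).toReal := by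
  rw [map_subgroupCongr_symm_tH_endoTorus_flipSet_eq L t tH hd₃ hC hCH νH mH hWH S hc hTm (chartTorusH_eq_centralizer_of_mem_regS L S (ArchCartan.regG_subset_regS S hc)) hP]

include hC hCH hWH in
/-- **The box mass `M(c)` is positive** (a Haar measure of a compact set with nonempty interior: ★ B2 `measure_chartBoxImg_pos`, ★ (T-MEAS) `isCompact_chartBoxImg`).
[cite: Rogawski1990, §1.7 p. 6] [cite: Folland1995, §2.2] -/
theorem toReal_map_tH_endoTorus_chartBoxImg_pos (S : Finset {w : InfinitePlace L // IsComplex w})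
    {c : {w : InfinitePlace L // IsComplex w} → Fin 3 → ℝ} (hc : c ∈ ArchCartan.RegG S) :
    0 < ((tH (endoTorus L S c)).map ⇑(MulEquiv.subgroupCongr (chartTorusH_eq_centralizer_of_mem_regS L S (ArchCartan.regG_subset_regS S hc))).symm (chartBoxImg L S)).toReal := by
  have hreg : IsArchGRegular L (endoTorus L S c) := (isArchGRegular_endoTorus_iff_mem_regG L S c).2 hc
  obtain ⟨iH, -, -⟩ := atPoint_eq_quotientMeasure_tH_of_isArchGRegular L t tH hd₃ hC hCH νH mH hWH (endoTorus L S c) hreg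
  haveI := iH
  haveI := locallyCompactSpace_chartTorusH L S
  set hP₀ := chartTorusH_eq_centralizer_of_mem_regS L S (ArchCartan.regG_subset_regS S hc)
  haveI : (Measure.map ⇑(MulEquiv.subgroupCongr hP₀).symm (tH (endoTorus L S c))).IsHaarMeasure :=
    (MulEquiv.subgroupCongr hP₀).symm.isHaarMeasure_map (tH (endoTorus L S c)) (continuous_subtype_val.subtype_mk _) (continuous_subtype_val.subtype_mk _)
  exact ENNReal.toReal_pos (measure_chartBoxImg_pos L S _).ne' (isCompact_chartBoxImg L S).measure_lt_top.ne

/-! ## §4 READ-H discharged: the stable orbital integral at a chart point IS the chart stable sum, up to the positive box mass `M(c)` -/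

include hC hCH hWH in
/-- **READ-H, UNCONDITIONAL IN THE FRAME**: for `c ∈ RegG S`,
`Φ^st(endoTorus S c, f_H; m_H) · M(c) = stableSum S (chartOrbH ν_H S f_H) c = ∑_{T ⊆ univ∖S} chartOrbH ν_H S f_H (flipSet T c)`, `M(c) > 0` the frame mass of the chart
box — ★ R4 `stableOrbitalIntegralRel_endoTorus_mul_eq_stableSum` with `hidx` ≔ ★ (UNIQ-H), `hinj` ≔ ★ p849928, `hbox` ≔ §3.
[cite: Rogawski1990, §4.1 (4.1.1) p. 39; §4.3 (4.3.1) p. 43; §14.3 pp. 233–234] [cite: Shelstad1979, §4 pp. 20–23] [cite: DeitmarEchterhoff2014, Thm. 1.5.3] -/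
theorem stableOrbitalIntegralRel_endoTorus_mul_boxMass_eq_stableSum (S : Finset {w : InfinitePlace L // IsComplex w})
    {c : {w : InfinitePlace L // IsComplex w} → Fin 3 → ℝ} (hc : c ∈ ArchCartan.RegG S) (fH : (↥(arch (↥(maximalRealSubfield L)) L (IsCMField.complexConj L) 2 (Matrix.of fun i j : Fin 2 => if i.val + j.val + 1 = 2 then (1 : L) else 0)) × ↥(arch (↥(maximalRealSubfield L)) L (IsCMField.complexConj L) 1 (Matrix.of fun i j : Fin 1 => if i.val + j.val + 1 = 1 then (1 : L) else 0))) → ℂ) :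
    stableOrbitalIntegralRel (IsArchStablyConjH L) mH fH (endoTorus L S c) *
        (((tH (endoTorus L S c)).map ⇑(MulEquiv.subgroupCongr (chartTorusH_eq_centralizer_of_mem_regS L S (ArchCartan.regG_subset_regS S hc))).symm (chartBoxImg L S)).toReal : ℂ) =
      stableSum S (chartOrbH L νH S fH) c :=
  stableOrbitalIntegralRel_endoTorus_mul_eq_stableSum L t tH hd₃ hC hCH νH mH hWH S hc fH (setOf_isArchStablyConjH_out_eq_image_flipSet L S hc)
    (injOn_conjClassesMk_endoTorus_flipSet L S (ArchCartan.regG_subset_regS S hc)) _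
    (fun _ hT hP => toReal_map_tH_endoTorus_flipSet_chartBoxImg_eq L t tH hd₃ hC hCH νH mH hWH S hc hT hP)

include hC hCH hWH in
/-- **The same in the D2-pack's family currency**: `Φ^st(endoTorus S c, f_H; m_H) · M(c) · archRH S c = stOrbFamH ν_H f_H S c` on `RegG S`.
[cite: Rogawski1990, §4.1 (4.1.1) p. 39; §14.3 pp. 233–234] [cite: Shelstad1979, §4 p. 22] -/
theorem stableOrbitalIntegralRel_endoTorus_mul_boxMass_eq_stOrbFamH (S : Finset {w : InfinitePlace L // IsComplex w})
    {c : {w : InfinitePlace L // IsComplex w} → Fin 3 → ℝ} (hc : c ∈ ArchCartan.RegG S) (fH : (↥(arch (↥(maximalRealSubfield L)) L (IsCMField.complexConj L) 2 (Matrix.of fun i j : Fin 2 => if i.val + j.val + 1 = 2 then (1 : L) else 0)) × ↥(arch (↥(maximalRealSubfield L)) L (IsCMField.complexConj L) 1 (Matrix.of fun i j : Fin 1 => if i.val + j.val + 1 = 1 then (1 : L) else 0))) → ℂ) :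
    stableOrbitalIntegralRel (IsArchStablyConjH L) mH fH (endoTorus L S c) *
        (((tH (endoTorus L S c)).map ⇑(MulEquiv.subgroupCongr (chartTorusH_eq_centralizer_of_mem_regS L S (ArchCartan.regG_subset_regS S hc))).symm (chartBoxImg L S)).toReal : ℂ) *
        archRH S c = stOrbFamH L νH fH S c :=
  stableOrbitalIntegralRel_endoTorus_mul_eq_stOrbFamH L t tH hd₃ hC hCH νH mH hWH S hc fH (setOf_isArchStablyConjH_out_eq_image_flipSet L S hc)
    (injOn_conjClassesMk_endoTorus_flipSet L S (ArchCartan.regG_subset_regS S hc)) _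
    (fun _ hT hP => toReal_map_tH_endoTorus_flipSet_chartBoxImg_eq L t tH hd₃ hC hCH νH mH hWH S hc hT hP)

end Frame

end Literature.NumberTheory.Rogawski1990

end
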